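import Literature.NumberTheory.Sieve.SieveFrameworkFundamentalLemma
import Literature.NumberTheory.Sieve.SieveFrameworkProofs
import HarnessLib

/-!
# Iwaniec's bilinear linear sieve, II: combinatorial sieves with general truncation conditions and
sign-selected composition of sieves on disjoint ranges of primes

Topic `Literature/NumberTheory/Sieve`; second support file for the proof of
`Literature.NumberTheory.Sieve.Iwaniec1978.lemma2_bilinearSieve` (H. Iwaniec, *A new form of the error
term in the linear sieve*, Acta Arith. 37 (1980), 307–320, Theorem 1 [IwaniecActaArith1980b]).
Two pieces of pure sieve combinatorics, both PROVED from Mathlib and the tree: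

* **Brun's combinatorial sieve with an arbitrary truncation condition** (`BetaSieve.predC par cond`,
  `indC`, `bdryC`): a squarefree `d = p₁ ⋯ p_r` (`p₁ > ⋯ > p_r`) is kept iff `cond (p₁ ⋯ p_m)` holds for
  every `m ≤ r` with `m ≡ par (mod 2)`; for ANY `cond : ℕ → Prop` the weights `μ(d) χ(d)` satisfy
  `∑_{d ∣ n} μ(d) χ⁻(d) ≤ [n = 1] ≤ ∑_{d ∣ n} μ(d) χ⁺(d)` (`BetaSieve.lower_sieveC`, `upper_sieveC`;
  Friedlander–Iwaniec, *Opera de Cribro*, §6.2, (6.25)–(6.31); the proofs are those of the tree's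
  `BetaSieve.upper_sieve` / `lower_sieve` for Rosser's condition `d · q(d)^β < D`, which is the special
  case `BetaSieve.pred_iff_predC`).  Iwaniec's box-truncated weights of §4 (conditions
  `D₁ ⋯ D_{2l} D_{2l+1}³ < D` on the BOXES of the primes, p. 311) are the instance used later; monotonicity
  in `cond` (`BetaSieve.predC_mono`) places them inside Rosser's set of level `D`.
* **Sign-selected composition** (`BetaSieve.compSel`): given weights `λ` on the divisors of `P_out` and a
  pair `φ⁺, φ⁻` of upper/lower sieve weights on the divisors of a coprime `P_in`, the weights
  `Λ(d) = λ(t) φ^{±}(e)` (`d = e t`, `e ∣ P_in`, `t ∣ P_out`), with the inner sign chosen as the sign of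
  `λ(t)` for an upper bound and opposite to it for a lower bound, form an upper (resp. lower) sieve on
  `P_in P_out` whenever `λ` does on `P_out` (`BetaSieve.upper_compSel`, `lower_compSel`); their main term
  is `∑_t λ(t) g(t) Φ^{±(t)}` (`BetaSieve.mainSum_compSel`), which differs from `Φ⁺ · ∑_t λ(t) g(t)` by at
  most `(Φ⁺ − Φ⁻) ∑_t |λ(t)| g(t)` (`BetaSieve.mainSum_compSel_upper_le` and twins).  This is the device
  of Iwaniec's §4–§5 ((17)–(18) with Lemma 4, and the first display of §5, p. 317: "if one replaces in
  (25) `φ⁻` by `φ⁺` we make an error which is less than …"), isolated as a lemma.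

## References

* H. Iwaniec, *A new form of the error term in the linear sieve*, Acta Arith. 37 (1980), 307–320, §§4–5.
  [IwaniecActaArith1980b]
* J. Friedlander, H. Iwaniec, *Opera de Cribro*, AMS Coll. Publ. 57 (2010), §6.2 (6.25)–(6.31),
  Cor. 6.2. [FriedlanderIwaniecOpera2010]
* G. Greaves, *Sieves in Number Theory*, Springer (2001), §3.1.2 Lemma 1. [Greaves2001]
-/

open Finset Real
open scoped ArithmeticFunction.Moebius

noncomputable section

namespace Literature.NumberTheory.Sieve

namespace BetaSieve

/-! ### Combinatorial sieves with a general truncation condition -/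

/-- The truncation predicate of a combinatorial sieve of parity `par` with condition `cond`: for
squarefree `d = p₁ ⋯ p_r` (`p₁ > ⋯ > p_r`), `predC par cond d` holds iff `cond (p₁ ⋯ p_m)` holds for every
`m ≤ r` with `m ≡ par (mod 2)` (`par = 1`: upper sieve, conditions at the odd positions; `par = 0`:
lower sieve).  Defined by recursion on removing the least prime factor, exactly as `BetaSieve.pred`
(Rosser's case `cond d ↔ d · q(d)^β < D`). [cite: FriedlanderIwaniecOpera2010, §6.2 (6.25)–(6.28)] -/
def predC (par : ℕ) (cond : ℕ → Prop) : ℕ → Prop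
  | d =>
    if _ : d ≤ 1 then True
    else predC par cond (d / d.minFac) ∧ (d.primeFactors.card % 2 = par % 2 → cond d)
termination_by d => d
decreasing_by exact Nat.div_lt_self (by omega) (Nat.minFac_prime (by omega)).one_lt

variable {par : ℕ} {cond cond' : ℕ → Prop}

/-- `d ≤ 1` is always kept. [folklore] -/
theorem predC_of_le_one {d : ℕ} (h : d ≤ 1) : predC par cond d := by
  rw [predC, dif_pos h]; trivial

/-- `1` is kept. [folklore] -/
theorem predC_one : predC par cond 1 := predC_of_le_one le_rfl

/-- Unfolding the recursion at `d > 1`. [folklore] -/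
theorem predC_iff {d : ℕ} (h : 1 < d) :
    predC par cond d ↔ predC par cond (d / d.minFac) ∧ (d.primeFactors.card % 2 = par % 2 → cond d) := by
  rw [predC, dif_neg (not_le.mpr h)]

/-- Unfolding at `d * p` when the prime `p` lies below all prime factors of `d`. [folklore] -/
theorem predC_mul_iff {d p : ℕ} (hp : p.Prime) (hd : d ≠ 0) (hlt : ∀ q ∈ d.primeFactors, p < q) :
    predC par cond (d * p) ↔ predC par cond d ∧
      ((d.primeFactors.card + 1) % 2 = par % 2 → cond (d * p)) := by
  have h1 : 1 < d * p := by
    have := hp.one_lt; have : 1 ≤ d := Nat.one_le_iff_ne_zero.mpr hd; nlinarith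
  rw [predC_iff h1, minFac_mul_eq hp hd hlt, Nat.mul_div_cancel _ hp.pos,
    card_primeFactors_mul_prime hp hd (not_dvd_of_lt_primeFactors hp hd hlt)]

/-- Heredity: `d p` kept implies `d` kept (for `p` below the prime factors of `d`). [folklore] -/
theorem predC_of_predC_mul {d p : ℕ} (hp : p.Prime) (hd : d ≠ 0) (hlt : ∀ q ∈ d.primeFactors, p < q)
    (h : predC par cond (d * p)) : predC par cond d :=
  ((predC_mul_iff hp hd hlt).mp h).1

/-- **Monotonicity in the condition**: a weaker condition keeps more. [folklore] -/
theorem predC_mono (hcc : ∀ d, cond d → cond' d) : ∀ {d : ℕ}, predC par cond d → predC par cond' d := by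
  intro d
  induction d using Nat.strong_induction_on with
  | _ d ih =>
    intro h
    by_cases h1 : d ≤ 1
    · exact predC_of_le_one h1
    have h1' : 1 < d := not_le.mp h1
    rw [predC_iff h1'] at h ⊢
    have hlt : d / d.minFac < d := Nat.div_lt_self (by omega) (Nat.minFac_prime (by omega)).one_lt
    exact ⟨ih _ hlt h.1, fun hpar => hcc d (h.2 hpar)⟩

/-- **Rosser's sets are the case `cond d ↔ d · q(d)^β < D`** of `predC`. [folklore] -/
theorem pred_iff_predC {β D : ℝ} :
    ∀ {d : ℕ}, pred par β D d ↔ predC par (fun d => (d : ℝ) * (d.minFac : ℝ) ^ β < D) d := by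
  intro d
  induction d using Nat.strong_induction_on with
  | _ d ih =>
    by_cases h1 : d ≤ 1
    · exact ⟨fun _ => predC_of_le_one h1, fun _ => pred_of_le_one h1⟩
    have h1' : 1 < d := not_le.mp h1
    have hlt : d / d.minFac < d := Nat.div_lt_self (by omega) (Nat.minFac_prime (by omega)).one_lt
    rw [pred_iff h1', predC_iff h1', ih _ hlt]

/-- The weight `χ(d) ∈ {0, 1}` of the general combinatorial sieve. [folklore] -/
def indC (par : ℕ) (cond : ℕ → Prop) (d : ℕ) : ℝ := by
  classical exact if predC par cond d then 1 else 0

/-- `χ(d) = 1` on the truncation set. [folklore] -/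
theorem indC_of_predC {d : ℕ} (h : predC par cond d) : indC par cond d = 1 := by
  simp [indC, h]

/-- `χ(d) = 0` off the truncation set. [folklore] -/
theorem indC_of_not_predC {d : ℕ} (h : ¬ predC par cond d) : indC par cond d = 0 := by
  simp [indC, h]

/-- `χ(1) = 1`. [folklore] -/
theorem indC_one : indC par cond 1 = 1 := indC_of_predC predC_one

/-- `0 ≤ χ(d)`. [folklore] -/
theorem indC_nonneg (d : ℕ) : 0 ≤ indC par cond d := by
  by_cases h : predC par cond d
  · rw [indC_of_predC h]; exact zero_le_one
  · rw [indC_of_not_predC h]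

/-- `χ(d) ≤ 1`. [folklore] -/
theorem indC_le_one (d : ℕ) : indC par cond d ≤ 1 := by
  by_cases h : predC par cond d
  · rw [indC_of_predC h]
  · rw [indC_of_not_predC h]; exact zero_le_one

/-- `|μ(d) χ(d)| ≤ 1`. [folklore] -/
theorem abs_moebius_mul_indC_le_one (d : ℕ) : |(μ d : ℝ) * indC par cond d| ≤ 1 := by
  rw [abs_mul]
  have hμ : |(μ d : ℝ)| ≤ 1 := by exact_mod_cast ArithmeticFunction.abs_moebius_le_one
  have hχ : |indC par cond d| ≤ 1 := by
    rw [abs_of_nonneg (indC_nonneg d)]; exact indC_le_one d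
  exact mul_le_one₀ hμ (abs_nonneg _) hχ

/-- The boundary indicator `χ̄(t) = χ(t/q(t)) − χ(t) ∈ {0, 1}`. [folklore] -/
def bdryC (par : ℕ) (cond : ℕ → Prop) (t : ℕ) : ℝ := by
  classical exact if predC par cond (t / t.minFac) ∧ ¬ predC par cond t then 1 else 0

/-- `0 ≤ χ̄(t)`. [folklore] -/
theorem bdryC_nonneg (t : ℕ) : 0 ≤ bdryC par cond t := by
  unfold bdryC; split_ifs <;> norm_num

/-- `χ(d p) = χ(d) − χ̄(d p)` for `p` below the prime factors of `d`. [folklore] -/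
theorem indC_mul_eq {d p : ℕ} (hp : p.Prime) (hd : d ≠ 0) (hlt : ∀ q ∈ d.primeFactors, p < q) :
    indC par cond (d * p) = indC par cond d - bdryC par cond (d * p) := by
  have hdiv : d * p / (d * p).minFac = d := by
    rw [minFac_mul_eq hp hd hlt, Nat.mul_div_cancel _ hp.pos]
  unfold bdryC
  rw [hdiv]
  by_cases h1 : predC par cond d
  · by_cases h2 : predC par cond (d * p)
    · rw [indC_of_predC h1, indC_of_predC h2, if_neg (fun h => h.2 h2)]; ring
    · rw [indC_of_predC h1, indC_of_not_predC h2, if_pos ⟨h1, h2⟩]; ring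
  · have h2 : ¬ predC par cond (d * p) := fun h => h1 (predC_of_predC_mul hp hd hlt h)
    rw [indC_of_not_predC h1, indC_of_not_predC h2, if_neg (fun h => h1 h.1)]; ring

/-- When `χ̄(d p) ≠ 0` the index `ν(d p) = ν(d) + 1` has the parity `par`. [folklore] -/
theorem bdryC_mul_eq_zero_of_parity {d p : ℕ} (hp : p.Prime) (hd : d ≠ 0)
    (hlt : ∀ q ∈ d.primeFactors, p < q) (hpar : (d.primeFactors.card + 1) % 2 ≠ par % 2) :
    bdryC par cond (d * p) = 0 := by
  unfold bdryC
  rw [if_neg]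
  rintro ⟨h1, h2⟩
  rw [minFac_mul_eq hp hd hlt, Nat.mul_div_cancel _ hp.pos] at h1
  exact h2 ((predC_mul_iff hp hd hlt).mpr ⟨h1, fun h => absurd h hpar⟩)

/-- One Buchstab step: `∑_{d ∣ n} μ(d) χ(d) = ∑_{d ∣ n/q(n)} μ(d) χ̄(d q(n))` for squarefree `n ≠ 1`.
[cite: Greaves2001, §3.1.2 Lemma 2, (2.15)] -/
theorem sum_moebius_indC_eq {n : ℕ} (hn : Squarefree n) (h1 : n ≠ 1) :
    ∑ d ∈ n.divisors, (μ d : ℝ) * indC par cond d =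
      ∑ d ∈ (n / n.minFac).divisors, (μ d : ℝ) * bdryC par cond (d * n.minFac) := by
  have hp := Nat.minFac_prime h1
  conv_lhs => rw [← div_minFac_mul (A := n)]
  rw [sum_divisors_mul_prime hp (not_minFac_dvd_div hn h1), ← Finset.sum_add_distrib]
  refine Finset.sum_congr rfl fun d hd => ?_
  obtain ⟨hd0, hlt, hpd, -⟩ := of_mem_divisors_div hn h1 hd
  rw [moebius_mul_prime hp hpd, indC_mul_eq hp hd0 hlt]
  ring

/-- **Upper sieve inequality for an arbitrary truncation condition**: `[n = 1] ≤ ∑_{d ∣ n} μ(d) χ⁺(d)`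
for squarefree `n` (Brun; conditions imposed at the odd positions only).
[cite: FriedlanderIwaniecOpera2010, §6.2 (6.29)] -/
theorem upper_sieveC {n : ℕ} (hn : Squarefree n) :
    (if n = 1 then (1 : ℝ) else 0) ≤ ∑ d ∈ n.divisors, (μ d : ℝ) * indC 1 cond d := by
  by_cases h1 : n = 1
  · subst h1; simp [indC_one]
  rw [if_neg h1, sum_moebius_indC_eq hn h1]
  refine Finset.sum_nonneg fun d hd => ?_
  obtain ⟨hd0, hlt, hpd, hsq⟩ := of_mem_divisors_div hn h1 hd
  by_cases hpar : (d.primeFactors.card + 1) % 2 = 1 % 2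
  · have heven : Even d.primeFactors.card := by
      rw [Nat.even_iff]; omega
    rw [moebius_of_squarefree hsq, heven.neg_one_pow, one_mul]
    exact bdryC_nonneg _
  · rw [bdryC_mul_eq_zero_of_parity (Nat.minFac_prime h1) hd0 hlt hpar, mul_zero]

/-- **Lower sieve inequality for an arbitrary truncation condition**: `∑_{d ∣ n} μ(d) χ⁻(d) ≤ [n = 1]`
for squarefree `n` (conditions at the even positions only). [cite: FriedlanderIwaniecOpera2010, §6.2 (6.30)] -/
theorem lower_sieveC {n : ℕ} (hn : Squarefree n) :
    ∑ d ∈ n.divisors, (μ d : ℝ) * indC 0 cond d ≤ (if n = 1 then (1 : ℝ) else 0) := by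
  by_cases h1 : n = 1
  · subst h1; simp [indC_one]
  rw [if_neg h1, sum_moebius_indC_eq hn h1]
  refine Finset.sum_nonpos fun d hd => ?_
  obtain ⟨hd0, hlt, hpd, hsq⟩ := of_mem_divisors_div hn h1 hd
  by_cases hpar : (d.primeFactors.card + 1) % 2 = 0 % 2
  · have hodd : Odd d.primeFactors.card := by
      rw [Nat.odd_iff]; omega
    rw [moebius_of_squarefree hsq, hodd.neg_one_pow, neg_one_mul, neg_nonpos]
    exact bdryC_nonneg _
  · rw [bdryC_mul_eq_zero_of_parity (Nat.minFac_prime h1) hd0 hlt hpar, mul_zero]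

/-! ### Sign-selected composition of sieves on coprime ranges -/

/-- The inner weight selected by the sign of the outer weight `x = λ(t)`: for an upper composite
(`par = 1`) use `φ⁺` when `x ≥ 0` and `φ⁻` when `x < 0`; for a lower composite (`par = 0`) the other
way round. [cite: IwaniecActaArith1980b, §4 (17)–(18) with Lemma 4] -/
def innerSel (par : ℕ) (phiP phiM : ℕ → ℝ) (x : ℝ) (e : ℕ) : ℝ :=
  if (0 ≤ x ↔ par % 2 = 1) then phiP e else phiM e

/-- **The sign-selected composite weights** `Λ(d) = λ(t) φ^{±}(e)`, `t = (d, P_out)`, `e = (d, P_in)`,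
with the inner sign selected by `innerSel`. [cite: IwaniecActaArith1980b, §4 (17)–(18) with Lemma 4] -/
def compSel (par : ℕ) (lam phiP phiM : ℕ → ℝ) (Pin Pout d : ℕ) : ℝ :=
  lam (Nat.gcd d Pout) * innerSel par phiP phiM (lam (Nat.gcd d Pout)) (Nat.gcd d Pin)

variable {lam phiP phiM : ℕ → ℝ} {Pin Pout : ℕ}

/-- Unfolding lemma for `compSel`. [folklore] -/
theorem compSel_apply (par : ℕ) (lam phiP phiM : ℕ → ℝ) (Pin Pout d : ℕ) :
    compSel par lam phiP phiM Pin Pout d =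
      lam (Nat.gcd d Pout) * innerSel par phiP phiM (lam (Nat.gcd d Pout)) (Nat.gcd d Pin) := rfl

/-- `|innerSel| ≤ 1` when `|φ^±| ≤ 1`. [folklore] -/
theorem abs_innerSel_le_one (hP : ∀ e, |phiP e| ≤ 1) (hM : ∀ e, |phiM e| ≤ 1) (par : ℕ) (x : ℝ)
    (e : ℕ) : |innerSel par phiP phiM x e| ≤ 1 := by
  unfold innerSel; split_ifs
  · exact hP e
  · exact hM e

/-- `|Λ(d)| ≤ 1` when `|λ|, |φ^±| ≤ 1`. [folklore] -/
theorem abs_compSel_le_one (hlam : ∀ t, |lam t| ≤ 1) (hP : ∀ e, |phiP e| ≤ 1)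
    (hM : ∀ e, |phiM e| ≤ 1) (par : ℕ) (d : ℕ) : |compSel par lam phiP phiM Pin Pout d| ≤ 1 := by
  rw [compSel_apply, abs_mul]
  exact mul_le_one₀ (hlam _) (abs_nonneg _) (abs_innerSel_le_one hP hM par _ _)

/-- At `d = e t` with `e ∣ P_in`, `t ∣ P_out` (coprime ranges): `Λ(e t) = λ(t) φ^{±(t)}(e)`.
[folklore] -/
theorem compSel_mul (hcop : Nat.Coprime Pin Pout) {e t : ℕ} (he : e ∣ Pin) (ht : t ∣ Pout)
    (par : ℕ) :
    compSel par lam phiP phiM Pin Pout (e * t) = lam t * innerSel par phiP phiM (lam t) e := by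
  have het : Nat.Coprime e Pout := Nat.Coprime.coprime_dvd_left he hcop
  have hte : Nat.Coprime t Pin := Nat.Coprime.coprime_dvd_left ht hcop.symm
  have h1 : Nat.gcd (e * t) Pout = t := by
    rw [Nat.Coprime.gcd_mul_left_cancel t het]; exact Nat.gcd_eq_left ht
  have h2 : Nat.gcd (e * t) Pin = e := by
    rw [mul_comm, Nat.Coprime.gcd_mul_left_cancel e hte]; exact Nat.gcd_eq_left he
  rw [compSel_apply, h1, h2]

/-- A divisor of `P_in P_out` (coprime) factors as `(n, P_in) · (n, P_out)`. [folklore] -/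
theorem eq_gcd_mul_gcd_of_dvd (hcop : Nat.Coprime Pin Pout) {n : ℕ} (hn : n ∣ Pin * Pout) :
    n = Nat.gcd n Pin * Nat.gcd n Pout := by
  rw [← Nat.Coprime.gcd_mul n hcop]; exact (Nat.gcd_eq_left hn).symm

/-- **The upper sign-selected composite is an upper sieve.**  If `λ` is an upper sieve on the divisors
of `P_out` and `φ⁻, φ⁺` are lower/upper sieves on the divisors of a coprime `P_in`, then
`[n = 1] ≤ ∑_{d ∣ n} Λ⁺(d)` for every `n ∣ P_in P_out`.  (Terms with `λ(t) ≥ 0` carry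
`∑_{e ∣ a} φ⁺(e) ≥ [a = 1]`, terms with `λ(t) < 0` carry `∑ φ⁻ ≤ [a = 1]`; so the sum is
`≥ [a = 1] ∑_{t ∣ b} λ(t) ≥ [a = 1][b = 1]`, `n = a b`.) [cite: IwaniecActaArith1980b, §4 (17) with Lemma 4] -/
theorem upper_compSel (hcop : Nat.Coprime Pin Pout)
    (hlam : ∀ b, b ∣ Pout → (if b = 1 then (1 : ℝ) else 0) ≤ ∑ t ∈ b.divisors, lam t)
    (hP : ∀ a, a ∣ Pin → (if a = 1 then (1 : ℝ) else 0) ≤ ∑ e ∈ a.divisors, phiP e)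
    (hM : ∀ a, a ∣ Pin → ∑ e ∈ a.divisors, phiM e ≤ (if a = 1 then (1 : ℝ) else 0))
    {n : ℕ} (hn : n ∣ Pin * Pout) :
    (if n = 1 then (1 : ℝ) else 0) ≤ ∑ d ∈ n.divisors, compSel 1 lam phiP phiM Pin Pout d := by
  set a := Nat.gcd n Pin with ha
  set b := Nat.gcd n Pout with hb
  have haP : a ∣ Pin := Nat.gcd_dvd_right _ _
  have hbP : b ∣ Pout := Nat.gcd_dvd_right _ _
  have hab : Nat.Coprime a b :=
    Nat.Coprime.coprime_dvd_left haP (Nat.Coprime.coprime_dvd_right hbP hcop)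
  have hnab : n = a * b := eq_gcd_mul_gcd_of_dvd hcop hn
  rw [hnab, sum_divisors_mul_of_coprime hab]
  have hterm : ∀ e ∈ a.divisors, ∀ t ∈ b.divisors,
      compSel 1 lam phiP phiM Pin Pout (e * t) = lam t * innerSel 1 phiP phiM (lam t) e :=
    fun e he t ht => compSel_mul hcop ((Nat.dvd_of_mem_divisors he).trans haP)
      ((Nat.dvd_of_mem_divisors ht).trans hbP) 1
  rw [Finset.sum_congr rfl fun e he => Finset.sum_congr rfl fun t ht => hterm e he t ht,
    Finset.sum_comm]
  -- each `t` contributes at least `λ(t) [a = 1]`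
  have hkey : ∀ t ∈ b.divisors, lam t * (if a = 1 then (1 : ℝ) else 0) ≤
      ∑ e ∈ a.divisors, lam t * innerSel 1 phiP phiM (lam t) e := by
    intro t _
    rw [← Finset.mul_sum]
    unfold innerSel
    by_cases h0 : 0 ≤ lam t
    · simp only [h0, show (1 : ℕ) % 2 = 1 from rfl, if_true]
      exact mul_le_mul_of_nonneg_left (hP a haP) h0
    · simp only [h0, false_iff, show (1 : ℕ) % 2 = 1 from rfl, not_true, if_false]
      exact mul_le_mul_of_nonpos_left (hM a haP) (le_of_lt (not_le.mp h0))
  refine le_trans ?_ (Finset.sum_le_sum hkey)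
  rw [← Finset.sum_mul]
  by_cases ha1 : a = 1
  · rw [if_pos ha1, mul_one, ha1, one_mul]; exact hlam b hbP
  · rw [if_neg ha1, mul_zero, if_neg]
    intro h
    exact ha1 (Nat.eq_one_of_mul_eq_one_right h)

/-- **The lower sign-selected composite is a lower sieve**: `∑_{d ∣ n} Λ⁻(d) ≤ [n = 1]` for every
`n ∣ P_in P_out`, if `λ` is a lower sieve on `P_out` (inner signs opposite to the sign of `λ(t)`).
[cite: IwaniecActaArith1980b, §4 (18) with Lemma 4] -/
theorem lower_compSel (hcop : Nat.Coprime Pin Pout)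
    (hlam : ∀ b, b ∣ Pout → ∑ t ∈ b.divisors, lam t ≤ (if b = 1 then (1 : ℝ) else 0))
    (hP : ∀ a, a ∣ Pin → (if a = 1 then (1 : ℝ) else 0) ≤ ∑ e ∈ a.divisors, phiP e)
    (hM : ∀ a, a ∣ Pin → ∑ e ∈ a.divisors, phiM e ≤ (if a = 1 then (1 : ℝ) else 0))
    {n : ℕ} (hn : n ∣ Pin * Pout) :
    ∑ d ∈ n.divisors, compSel 0 lam phiP phiM Pin Pout d ≤ (if n = 1 then (1 : ℝ) else 0) := by
  set a := Nat.gcd n Pin with ha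
  set b := Nat.gcd n Pout with hb
  have haP : a ∣ Pin := Nat.gcd_dvd_right _ _
  have hbP : b ∣ Pout := Nat.gcd_dvd_right _ _
  have hab : Nat.Coprime a b :=
    Nat.Coprime.coprime_dvd_left haP (Nat.Coprime.coprime_dvd_right hbP hcop)
  have hnab : n = a * b := eq_gcd_mul_gcd_of_dvd hcop hn
  rw [hnab, sum_divisors_mul_of_coprime hab]
  have hterm : ∀ e ∈ a.divisors, ∀ t ∈ b.divisors,
      compSel 0 lam phiP phiM Pin Pout (e * t) = lam t * innerSel 0 phiP phiM (lam t) e :=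
    fun e he t ht => compSel_mul hcop ((Nat.dvd_of_mem_divisors he).trans haP)
      ((Nat.dvd_of_mem_divisors ht).trans hbP) 0
  rw [Finset.sum_congr rfl fun e he => Finset.sum_congr rfl fun t ht => hterm e he t ht,
    Finset.sum_comm]
  have hkey : ∀ t ∈ b.divisors, ∑ e ∈ a.divisors, lam t * innerSel 0 phiP phiM (lam t) e ≤
      lam t * (if a = 1 then (1 : ℝ) else 0) := by
    intro t _
    rw [← Finset.mul_sum]
    unfold innerSel
    by_cases h0 : 0 ≤ lam t
    · simp only [h0, true_iff, show (0 : ℕ) % 2 = 0 from rfl, zero_ne_one, if_false]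
      exact mul_le_mul_of_nonneg_left (hM a haP) h0
    · simp only [h0, show (0 : ℕ) % 2 = 0 from rfl, zero_ne_one,
        if_true]
      exact mul_le_mul_of_nonpos_left (hP a haP) (le_of_lt (not_le.mp h0))
  refine le_trans (Finset.sum_le_sum hkey) ?_
  rw [← Finset.sum_mul]
  by_cases ha1 : a = 1
  · rw [if_pos ha1, mul_one, ha1, one_mul]; exact hlam b hbP
  · rw [if_neg ha1, mul_zero, if_neg]
    intro h
    exact ha1 (Nat.eq_one_of_mul_eq_one_right h)

/-- **Main term of a sign-selected composite**: for multiplicative `g` and coprime `P_in`, `P_out`,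
`∑_{d ∣ P_in P_out} Λ(d) g(d) = ∑_{t ∣ P_out} λ(t) g(t) Φ^{±(t)}` with `Φ^± = ∑_{e ∣ P_in} φ^±(e) g(e)`.
[cite: IwaniecActaArith1980b, §4 (25)–(26)] -/
theorem mainSum_compSel {g : ArithmeticFunction ℝ} (hg : g.IsMultiplicative)
    (hcop : Nat.Coprime Pin Pout) (par : ℕ) :
    ∑ d ∈ (Pin * Pout).divisors, compSel par lam phiP phiM Pin Pout d * g d =
      ∑ t ∈ Pout.divisors, lam t * g t *
        (if (0 ≤ lam t ↔ par % 2 = 1) then ∑ e ∈ Pin.divisors, phiP e * g e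
          else ∑ e ∈ Pin.divisors, phiM e * g e) := by
  rw [sum_divisors_mul_of_coprime hcop, Finset.sum_comm]
  refine Finset.sum_congr rfl fun t ht => ?_
  have htP := Nat.dvd_of_mem_divisors ht
  have hterm : ∀ e ∈ Pin.divisors, compSel par lam phiP phiM Pin Pout (e * t) * g (e * t) =
      lam t * g t * (innerSel par phiP phiM (lam t) e * g e) := by
    intro e he
    have heP := Nat.dvd_of_mem_divisors he
    have het : Nat.Coprime e t := Nat.Coprime.coprime_dvd_left heP (Nat.Coprime.coprime_dvd_right htP hcop)
    rw [compSel_mul hcop heP htP, hg.map_mul_of_coprime het]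
    ring
  rw [Finset.sum_congr rfl hterm, ← Finset.mul_sum]
  congr 1
  unfold innerSel
  split_ifs <;> rfl

/-- **Replacing `Φ⁻` by `Φ⁺` in the upper composite** (Iwaniec, §5, first display): with `g ≥ 0` on the
divisors of `P_out` and `Φ⁻ ≤ Φ⁺`,
`∑_{d} Λ⁺(d) g(d) ≤ Φ⁺ ∑_{t ∣ P_out} λ(t) g(t) + (Φ⁺ − Φ⁻) ∑_{t ∣ P_out} |λ(t)| g(t)`.
[cite: IwaniecActaArith1980b, §5 p. 317] -/
theorem mainSum_compSel_one_le {g : ArithmeticFunction ℝ} (hg : g.IsMultiplicative)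
    (hcop : Nat.Coprime Pin Pout) (hg0 : ∀ t ∈ Pout.divisors, 0 ≤ g t)
    (hΦ : ∑ e ∈ Pin.divisors, phiM e * g e ≤ ∑ e ∈ Pin.divisors, phiP e * g e) :
    ∑ d ∈ (Pin * Pout).divisors, compSel 1 lam phiP phiM Pin Pout d * g d ≤
      (∑ e ∈ Pin.divisors, phiP e * g e) * ∑ t ∈ Pout.divisors, lam t * g t +
        ((∑ e ∈ Pin.divisors, phiP e * g e) - ∑ e ∈ Pin.divisors, phiM e * g e) *
          ∑ t ∈ Pout.divisors, |lam t| * g t := by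
  set ΦP := ∑ e ∈ Pin.divisors, phiP e * g e
  set ΦM := ∑ e ∈ Pin.divisors, phiM e * g e
  rw [mainSum_compSel hg hcop 1, Finset.mul_sum, Finset.mul_sum, ← Finset.sum_add_distrib]
  refine Finset.sum_le_sum fun t ht => ?_
  have hgt := hg0 t ht
  by_cases h0 : 0 ≤ lam t
  · simp only [h0, show (1 : ℕ) % 2 = 1 from rfl, if_true]
    have : 0 ≤ (ΦP - ΦM) * (|lam t| * g t) := mul_nonneg (by linarith) (mul_nonneg (abs_nonneg _) hgt)
    nlinarith
  · simp only [h0, false_iff, show (1 : ℕ) % 2 = 1 from rfl, not_true, if_false]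
    have hneg : lam t < 0 := not_le.mp h0
    rw [abs_of_neg hneg]
    nlinarith

/-- **Replacing `Φ⁺` by `Φ⁻` in the lower composite**: with `g ≥ 0` on the divisors of `P_out` and
`Φ⁻ ≤ Φ⁺`, `Φ⁻ ∑_{t ∣ P_out} λ(t) g(t) − (Φ⁺ − Φ⁻) ∑_{t} |λ(t)| g(t) ≤ ∑_{d} Λ⁻(d) g(d)`.
[cite: IwaniecActaArith1980b, §5 (28)] -/
theorem le_mainSum_compSel_zero {g : ArithmeticFunction ℝ} (hg : g.IsMultiplicative)
    (hcop : Nat.Coprime Pin Pout) (hg0 : ∀ t ∈ Pout.divisors, 0 ≤ g t)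
    (hΦ : ∑ e ∈ Pin.divisors, phiM e * g e ≤ ∑ e ∈ Pin.divisors, phiP e * g e) :
    (∑ e ∈ Pin.divisors, phiM e * g e) * ∑ t ∈ Pout.divisors, lam t * g t -
        ((∑ e ∈ Pin.divisors, phiP e * g e) - ∑ e ∈ Pin.divisors, phiM e * g e) *
          ∑ t ∈ Pout.divisors, |lam t| * g t ≤
      ∑ d ∈ (Pin * Pout).divisors, compSel 0 lam phiP phiM Pin Pout d * g d := by
  set ΦP := ∑ e ∈ Pin.divisors, phiP e * g e
  set ΦM := ∑ e ∈ Pin.divisors, phiM e * g e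
  rw [mainSum_compSel hg hcop 0, Finset.mul_sum, Finset.mul_sum, ← Finset.sum_sub_distrib]
  refine Finset.sum_le_sum fun t ht => ?_
  have hgt := hg0 t ht
  by_cases h0 : 0 ≤ lam t
  · simp only [h0, true_iff, show (0 : ℕ) % 2 = 0 from rfl, zero_ne_one, if_false]
    rw [abs_of_nonneg h0]
    have : 0 ≤ (ΦP - ΦM) * (lam t * g t) := mul_nonneg (by linarith) (mul_nonneg h0 hgt)
    nlinarith
  · simp only [h0, show (0 : ℕ) % 2 = 0 from rfl, zero_ne_one, if_true]
    have hneg : lam t < 0 := not_le.mp h0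
    rw [abs_of_neg hneg]
    nlinarith

/-! ### From pointwise sieve inequalities to a finite sequence of integers -/

/-- For `d ∣ P` and an integer `b`: `d ∣ (b, P)` iff `d ∣ b`. [folklore] -/
theorem dvd_int_gcd_iff {P d : ℕ} (hd : d ∣ P) (b : ℤ) : d ∣ Int.gcd b P ↔ (d : ℤ) ∣ b := by
  rw [Int.gcd, Int.natAbs_natCast, Nat.dvd_gcd_iff, Int.natCast_dvd]
  exact ⟨fun h => h.1, fun h => ⟨h, hd⟩⟩

/-- The weighted divisor sum of one integer `b` against the sieving range `P`:
`∑_{d ∣ P, d ∣ b} w(d) = ∑_{d ∣ (b, P)} w(d)`. [folklore] -/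
theorem sum_divisors_ite_dvd_eq {P : ℕ} (hP : P ≠ 0) (w : ℕ → ℝ) (b : ℤ) :
    ∑ d ∈ P.divisors, (if (d : ℤ) ∣ b then w d else 0) = ∑ d ∈ (Int.gcd b P).divisors, w d := by
  have hgP : Int.gcd b P ∣ P := by rw [Int.gcd, Int.natAbs_natCast]; exact Nat.gcd_dvd_right _ _
  have hg0 : Int.gcd b P ≠ 0 := fun h => hP (Nat.eq_zero_of_zero_dvd (h ▸ hgP))
  rw [← Finset.sum_filter]
  refine Finset.sum_congr ?_ fun _ _ => rfl
  ext d
  rw [Finset.mem_filter, Nat.mem_divisors, Nat.mem_divisors]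
  constructor
  · rintro ⟨⟨hdP, -⟩, hdb⟩; exact ⟨(dvd_int_gcd_iff hdP b).mpr hdb, hg0⟩
  · rintro ⟨hdg, -⟩
    have hdP : d ∣ P := hdg.trans hgP
    exact ⟨⟨hdP, hP⟩, (dvd_int_gcd_iff hdP b).mp hdg⟩

/-- **An upper sieve bounds the sifted count of a finite sequence of integers**: if
`[n = 1] ≤ ∑_{d ∣ n} w(d)` for all `n ∣ P` (`P ≠ 0`), then for every finite sequence `ℬ` of integers
`#{b ∈ ℬ : (b, P) = 1} ≤ ∑_{d ∣ P} w(d) #{b ∈ ℬ : d ∣ b}`. [cite: FriedlanderIwaniecOpera2010, §6.2 Cor. 6.2] -/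
theorem card_filter_gcd_le_sum {P : ℕ} (hP : P ≠ 0) {w : ℕ → ℝ}
    (hw : ∀ n, n ∣ P → (if n = 1 then (1 : ℝ) else 0) ≤ ∑ d ∈ n.divisors, w d) (B : Multiset ℤ) :
    ((B.filter fun b : ℤ => Int.gcd b P = 1).card : ℝ) ≤
      ∑ d ∈ P.divisors, w d * ((B.filter fun b : ℤ => (d : ℤ) ∣ b).card : ℝ) := by
  induction B using Multiset.induction_on with
  | empty => simp
  | cons b B ih =>
    rw [Multiset.filter_cons, Multiset.card_add, Nat.cast_add]
    have hstep : ∑ d ∈ P.divisors, w d * (((b ::ₘ B).filter fun b : ℤ => (d : ℤ) ∣ b).card : ℝ) =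
        ∑ d ∈ P.divisors, (if (d : ℤ) ∣ b then w d else 0) +
          ∑ d ∈ P.divisors, w d * ((B.filter fun b : ℤ => (d : ℤ) ∣ b).card : ℝ) := by
      rw [← Finset.sum_add_distrib]
      refine Finset.sum_congr rfl fun d _ => ?_
      rw [Multiset.filter_cons, Multiset.card_add, Nat.cast_add]
      split_ifs <;> simp; ring
    rw [hstep, sum_divisors_ite_dvd_eq hP w b]
    have hgcd : Int.gcd b P ∣ P := by rw [Int.gcd, Int.natAbs_natCast]; exact Nat.gcd_dvd_right _ _
    have h1 := hw _ hgcd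
    have hind : ((if Int.gcd b P = 1 then ({b} : Multiset ℤ) else 0).card : ℝ) =
        if Int.gcd b P = 1 then 1 else 0 := by split_ifs <;> simp
    rw [hind]
    linarith

/-- **A lower sieve bounds the sifted count from below**: if `∑_{d ∣ n} w(d) ≤ [n = 1]` for all
`n ∣ P` (`P ≠ 0`), then `∑_{d ∣ P} w(d) #{b ∈ ℬ : d ∣ b} ≤ #{b ∈ ℬ : (b, P) = 1}`.
[cite: FriedlanderIwaniecOpera2010, §6.2 Cor. 6.2] -/
theorem sum_le_card_filter_gcd {P : ℕ} (hP : P ≠ 0) {w : ℕ → ℝ}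
    (hw : ∀ n, n ∣ P → ∑ d ∈ n.divisors, w d ≤ (if n = 1 then (1 : ℝ) else 0)) (B : Multiset ℤ) :
    ∑ d ∈ P.divisors, w d * ((B.filter fun b : ℤ => (d : ℤ) ∣ b).card : ℝ) ≤
      ((B.filter fun b : ℤ => Int.gcd b P = 1).card : ℝ) := by
  induction B using Multiset.induction_on with
  | empty => simp
  | cons b B ih =>
    rw [Multiset.filter_cons, Multiset.card_add, Nat.cast_add]
    have hstep : ∑ d ∈ P.divisors, w d * (((b ::ₘ B).filter fun b : ℤ => (d : ℤ) ∣ b).card : ℝ) =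
        ∑ d ∈ P.divisors, (if (d : ℤ) ∣ b then w d else 0) +
          ∑ d ∈ P.divisors, w d * ((B.filter fun b : ℤ => (d : ℤ) ∣ b).card : ℝ) := by
      rw [← Finset.sum_add_distrib]
      refine Finset.sum_congr rfl fun d _ => ?_
      rw [Multiset.filter_cons, Multiset.card_add, Nat.cast_add]
      split_ifs <;> simp; ring
    rw [hstep, sum_divisors_ite_dvd_eq hP w b]
    have hgcd : Int.gcd b P ∣ P := by rw [Int.gcd, Int.natAbs_natCast]; exact Nat.gcd_dvd_right _ _
    have h1 := hw _ hgcd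
    have hind : ((if Int.gcd b P = 1 then ({b} : Multiset ℤ) else 0).card : ℝ) =
        if Int.gcd b P = 1 then 1 else 0 := by split_ifs <;> simp
    rw [hind]
    linarith

end BetaSieve

end Literature.NumberTheory.Sieve

end
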